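import Summits.Ventures.AbcSig.Rows.XTemplateC2a
import Summits.Ventures.AbcSig.Levels.N332
import Summits.Ventures.AbcSig.Levels.N664
import Summits.Ventures.AbcSig.Levels.N166

/-!
# Venture AbcSig — ROW `C2aL83A2`: `xⁿ + 2^2·83^m·yⁿ = z²`, class `a = 2`, over the level files 332 (norm-form certificates) and 664 (ordinary tree certificates) and 166 (ordinary tree certificates) (GENERATED by p-lean g4 `gen4/c2arow2.py`)

HONEST FRAMING. A row of a COMPUTATION cell (`pub-abcsig`); a CONDITIONAL theorem, no claim on ABC or any summit.
Hypotheses: `BS04Package` (CITED: [BS04] Lemma 3.3 + (3.1) + Lemma 4.2); `DataComplete` at both levels and `RefinesCPSymAll` at the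
norm-form level(s) (COMPUTED: certified engine-1 level files; `Sieve/CharpolyCert.lean` / `Sieve/CharpolyTwist.lean`);
and the listed per-orbit exclusions `hX_…` (CITED: the row of record's module closures — M4 Kraus / M6 / M8 / [BS04, Prop 4.4/4.6] as its R3
names them; nothing of those is checked here). Exponent range: prime `n ≥ 11`, `n ≠ 83`; `B = 2^2·83^m`, `1 ≤ m < n`
(RULING H1 reduced exponents).
Levels 332 = 4·83 (norm-form), 664 = 8·83 and 166 = 2·83 (tree): no residue ≥ 11 anywhere; residual of record: none; no cited exclusion.
Row of record: `census/rows/C2a/C2a-l83-a2.md` (sha16 `84b8fabb01c89f02`; R8-signed 2026-08-22T16:56:39Z by referee (ref-g12)).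
-/

namespace Summit.Ventures.AbcSig

/-- Row `C2aL83A2`: class `a = 2`, first distribution, prime `n ≥ 11`, `n ≠ 83`; conditional on the named hypotheses. -/
theorem xrow_C2aL83A2 (M : NewformModel) (hP : M.BS04Package)
    (hD332 : M.DataComplete 332 level332Orbits) (hCP332 : M.RefinesCPSymAll 332 level332CP)
    (hD664 : M.DataComplete 664 level664Orbits)
    (hD166 : M.DataComplete 166 level166Orbits)
    (n : ℕ) (hn : n.Prime) (hmin : 11 ≤ n) (hnℓ : n ≠ 83) (m : ℕ) (hm : 1 ≤ m) (hmn : m < n)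
    (x y z : ℤ) (hxy1 : x * y ≠ 1) (hxy2 : x * y ≠ -1) : ¬ IsPrimitiveSolution 1 (2 ^ 2 * 83 ^ m) 1 n x y z := by
  have hℓ : Nat.Prime 83 := by norm_num
  have h7 : 7 ≤ n := by omega
  exact xrowC2a_a2 83 hℓ (by norm_num) M hP n hn h7 hnℓ hD332 hD664 hD166 m hm hmn
    (level332_sieve M hP hCP332 n hn h7 (fun o => M.Excludes 332 o
      (famB (2 ^ 2 * 83 ^ m) n (fun _ _ => True)) ∨ M.ExcludesStd 332 o n) (fun _ h => Or.inr h) (fun hmem => by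
      obtain rfl : n = 7 := by simpa using hmem
      omega) (fun hmem => by
      obtain rfl : n = 7 := by simpa using hmem
      omega))
    (level664_sieve n hn h7 (fun o => M.Excludes 664 o
      (famB (2 ^ 2 * 83 ^ m) n (fun _ _ => True)) ∨ M.ExcludesStd 664 o n) (fun hmem => by
      obtain rfl : n = 7 := by simpa using hmem
      omega))
    (level166_sieve n hn h7 (fun o => M.Excludes 166 o
      (famB (2 ^ 2 * 83 ^ m) n (fun _ _ => True)) ∨ M.ExcludesStd 166 o n) (fun hmem => by
      obtain rfl : n = 7 := by simpa using hmem
      omega))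
    x y z hxy1 hxy2

end Summit.Ventures.AbcSig
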